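import Literature.NumberTheory.LFunctions.ZetaScrew
import Literature.NumberTheory.LFunctions.RiemannXiLogDeriv
import Literature.Analysis.SpecialFunctions.DigammaGauss
import Literature.Analysis.SpecialFunctions.DigammaReflection
import Mathlib.Analysis.SpecialFunctions.ImproperIntegrals
import Mathlib.MeasureTheory.Integral.IntegralEqImproper
import HarnessLib

/-!
# The one-sided Fourier–Laplace transform of Suzuki's screw function `Ψ` (Suzuki 2023, Thm 1.1 (1))

M. Suzuki, *Aspects of the screw function corresponding to the Riemann zeta-function*,
J. Lond. Math. Soc. 108 (2023) = arXiv:2206.03682, Theorem 1.1 (1): for `Im z > 1/2`,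

  `∫₀^∞ Ψ(t) e^{izt} dt = -z^{-2} (ξ'/ξ)(1/2 - iz)`,

where `Ψ = Literature.NumberTheory.LFunctions.zetaScrew` ((1.1) of the paper) and `ξ` is
Riemann's xi-function (`riemannXi`). This file PROVES the statement vendored as the named fact
`Literature.NumberTheory.LFunctions.Suzuki2023_thm11_fourier` (`ZetaScrew.lean`):
`Suzuki2023_thm11_fourier_holds`.

## Proof (Suzuki2023 §2.1, followed line by line)

Write `a = iz` (`Re a = -Im z < -1/2`) and `s = 1/2 - iz = 1/2 - a` (`Re s > 1`). On `t > 0`,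
`Ψ(t) = 4(e^{t/2} + e^{-t/2} - 2) - φ(t) - (t/2)κ + ¼ Σ_k (k+¼)^{-2}(1 - e^{-(2k+½)t})` with
`φ(t) = Σ_{n ≤ e^t} Λ(n) n^{-1/2}(t - log n)`, `κ = γ + π/2 + 3 log 2 + log π`
(`zetaScrew_eq`, `hasSum_hurwitzLerch_part`). The four Laplace transforms are
((2.1)–(2.3) of the paper, "by direct and simple calculation"):

* `∫₀^∞ 4(e^{t/2}+e^{-t/2}-2) e^{at} dt = 4(-1/(a+½) - 1/(a-½) + 2/a) = a^{-2}(1/s + 1/(s-1))`;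
* `∫₀^∞ t e^{at} dt = 1/a²` (`integral_ofReal_mul_cexp`);
* `∫₀^∞ φ(t) e^{at} dt = a^{-2} Σ_n Λ(n) n^{-s} = a^{-2} L(Λ, s)` (termwise,
  `∫₀^∞ (t - log n)₊ e^{at} dt = n^{a}/a²`, interchange justified by
  `Σ_n Λ(n) n^{-1/2+Re a} < ∞`, i.e. absolute convergence of `L(Λ, ½ - Re a)`);
* `∫₀^∞ ¼ Σ_k (k+¼)^{-2}(1 - e^{-(2k+½)t}) e^{at} dt = ¼ Σ_k (k+¼)^{-2}(-1/a + 1/(a-2k-½))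
   = (2a²)^{-1} Σ_k (1/(k+¼) - 1/(k+s/2)) = (2a²)^{-1} (ψ(s/2) - ψ(¼))`
  by the series `ψ(w) + γ = Σ_k (1/(k+1) - 1/(w+k))` ((2.5) of the paper; the tree's
  `Literature.Analysis.SpecialFunctions.Complex.hasSum_one_div_sub_one_div_digamma`).

Summing, with `ξ'/ξ(s) = 1/s + 1/(s-1) - ½ log π + ½ ψ(s/2) - L(Λ, s)` (the tree's
`logDeriv_riemannXi_eq_of_one_lt_re`) and Gauss's value `ψ(¼) = -(γ + π/2 + 3 log 2)`
(`Literature.Analysis.SpecialFunctions.Complex.digamma_one_quarter_eq_neg_ofReal`; the Lean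
definition of `Ψ` has this value of `(Γ'/Γ)(¼)` built in), the transform is `a^{-2} ξ'/ξ(s)`,
which is `-z^{-2} ξ'/ξ(1/2 - iz)`.

All statements in this file are proved; no new definitions of mathematical content (the
namespace `ZetaScrewLaplace` only holds the intermediate lemmas).

## References

* M. Suzuki, J. Lond. Math. Soc. (2) 108 (2023), 1448–1487, §2.1; arXiv:2206.03682. [Suzuki2023]
* G. E. Andrews, R. Askey, R. Roy, *Special Functions* (1999), Thm. 1.2.5 (1.2.13), Thm. 1.2.7.
  [AndrewsAskeyRoy1999]
-/

noncomputable section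

open Complex Filter Topology Set MeasureTheory ArithmeticFunction
open scoped Real LSeries.notation

namespace Literature.NumberTheory.LFunctions

namespace ZetaScrewLaplace

variable {a : ℂ}

/-! ### Elementary Laplace transforms on `(0, ∞)` -/

/-- `‖e^{at}‖ = e^{(Re a) t}` for real `t`. [folklore] -/
theorem norm_cexp_mul_ofReal (a : ℂ) (t : ℝ) : ‖cexp (a * t)‖ = Real.exp (a.re * t) := by
  rw [Complex.norm_exp]
  simp

/-- `e^{ct} · e^{at} = e^{(a+c)t}` (`c`, `t` real). [folklore] -/
theorem ofReal_exp_mul_cexp (c t : ℝ) (a : ℂ) :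
    (Real.exp (c * t) : ℂ) * cexp (a * t) = cexp ((a + c) * t) := by
  rw [Complex.ofReal_exp, ← Complex.exp_add]
  congr 1
  push_cast
  ring

/-- `∫₀^∞ e^{ct} e^{at} dt = -1/(a + c)` for `Re a < -c` (Suzuki2023 (2.1)). [cite: Suzuki2023, §2.1 (2.1)] -/
theorem integral_exp_mul_cexp {c : ℝ} (ha : a.re < -c) :
    ∫ t in Ioi (0 : ℝ), (Real.exp (c * t) : ℂ) * cexp (a * t) = -1 / (a + c) := by
  simp_rw [ofReal_exp_mul_cexp]
  have h : (a + c).re < 0 := by simp only [add_re, ofReal_re]; linarith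
  rw [integral_exp_mul_complex_Ioi h 0]
  simp [neg_div]

/-- Integrability of `e^{ct} e^{at}` on `(0, ∞)` for `Re a < -c`. [folklore] -/
theorem integrableOn_exp_mul_cexp {c : ℝ} (ha : a.re < -c) :
    IntegrableOn (fun t : ℝ ↦ (Real.exp (c * t) : ℂ) * cexp (a * t)) (Ioi 0) := by
  have h : (a + c).re < 0 := by simp only [add_re, ofReal_re]; linarith
  refine (integrableOn_exp_mul_complex_Ioi h 0).congr_fun (fun t _ ↦ ?_) measurableSet_Ioi
  exact (ofReal_exp_mul_cexp c t a).symm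

/-- `∫₀^∞ e^{at} dt = -1/a` for `Re a < 0`. [folklore] -/
theorem integral_cexp (ha : a.re < 0) : ∫ t in Ioi (0 : ℝ), cexp (a * t) = -1 / a := by
  rw [integral_exp_mul_complex_Ioi ha 0]
  simp [neg_div]

/-- `e^{at} → 0` as `t → +∞` for `Re a < 0`. [folklore] -/
theorem tendsto_cexp_atTop (ha : a.re < 0) : Tendsto (fun t : ℝ ↦ cexp (a * t)) atTop (𝓝 0) := by
  simpa [Complex.tendsto_exp_nhds_zero_iff] using tendsto_const_nhds.neg_mul_atTop ha tendsto_id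

/-- `t e^{rt} → 0` as `t → +∞` for `r < 0`. [folklore] -/
theorem tendsto_mul_exp_atTop {r : ℝ} (hr : r < 0) :
    Tendsto (fun t : ℝ ↦ t * Real.exp (r * t)) atTop (𝓝 0) := by
  have h1 := (Real.tendsto_pow_mul_exp_neg_atTop_nhds_zero 1).comp
    (tendsto_id.const_mul_atTop (neg_pos.2 hr))
  have h2 := h1.const_mul (1 / (-r))
  rw [mul_zero] at h2
  refine h2.congr fun t ↦ ?_
  simp only [Function.comp_apply, pow_one, id_eq]
  have hr0 : r ≠ 0 := hr.ne
  have : Real.exp (-(-r * t)) = Real.exp (r * t) := by ring_nf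
  rw [this]
  field_simp

/-- `t e^{at} → 0` in `ℂ` as `t → +∞` for `Re a < 0`. [folklore] -/
theorem tendsto_ofReal_mul_cexp_atTop (ha : a.re < 0) :
    Tendsto (fun t : ℝ ↦ (t : ℂ) * cexp (a * t)) atTop (𝓝 0) := by
  rw [tendsto_zero_iff_norm_tendsto_zero]
  have h := tendsto_mul_exp_atTop ha
  refine (h.congr' ?_)
  filter_upwards [eventually_ge_atTop 0] with t ht
  rw [norm_mul, norm_real, Real.norm_eq_abs, abs_of_nonneg ht, norm_cexp_mul_ofReal]

/-- The real function `t e^{rt}` is integrable on `(0, ∞)` for `r < 0` (it is the derivative of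
`(t/r - 1/r²) e^{rt} → 0`). [folklore] -/
theorem integrableOn_mul_exp {r : ℝ} (hr : r < 0) :
    IntegrableOn (fun t : ℝ ↦ t * Real.exp (r * t)) (Ioi 0) := by
  have hr0 : r ≠ 0 := hr.ne
  have hderiv : ∀ t ∈ Ioi (0 : ℝ),
      HasDerivAt (fun t : ℝ ↦ (t / r - 1 / r ^ 2) * Real.exp (r * t)) (t * Real.exp (r * t)) t := by
    intro t _
    have h1 : HasDerivAt (fun t : ℝ ↦ t / r - 1 / r ^ 2) (1 / r) t := by
      simpa using ((hasDerivAt_id t).div_const r).sub_const (1 / r ^ 2)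
    have h2 : HasDerivAt (fun t : ℝ ↦ Real.exp (r * t)) (Real.exp (r * t) * r) t := by
      simpa using ((hasDerivAt_id t).const_mul r).exp
    refine (h1.mul h2).congr_deriv ?_
    field_simp
    ring
  have hlim : Tendsto (fun t : ℝ ↦ (t / r - 1 / r ^ 2) * Real.exp (r * t)) atTop (𝓝 0) := by
    have h1 := (tendsto_mul_exp_atTop hr).const_mul (1 / r)
    have h2 : Tendsto (fun t : ℝ ↦ Real.exp (r * t)) atTop (𝓝 0) := by
      have : Tendsto (fun t : ℝ ↦ r * t) atTop atBot :=
        tendsto_id.const_mul_atTop_of_neg hr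
      exact Real.tendsto_exp_atBot.comp this
    have h3 := h2.const_mul (1 / r ^ 2)
    rw [mul_zero] at h1 h3
    have h4 := h1.sub h3
    rw [sub_zero] at h4
    refine h4.congr fun t ↦ ?_
    ring
  refine integrableOn_Ioi_deriv_of_nonneg ?_ hderiv
    (fun t ht ↦ mul_nonneg (le_of_lt ht) (Real.exp_pos _).le) hlim
  exact (by fun_prop : Continuous fun t : ℝ ↦ (t / r - 1 / r ^ 2) * Real.exp (r * t)).continuousWithinAt

/-- `t e^{at}` is integrable on `(0, ∞)` for `Re a < 0`. [folklore] -/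
theorem integrableOn_ofReal_mul_cexp (ha : a.re < 0) :
    IntegrableOn (fun t : ℝ ↦ (t : ℂ) * cexp (a * t)) (Ioi 0) := by
  refine (integrable_norm_iff (by fun_prop)).1 ?_
  refine (integrableOn_mul_exp ha).congr_fun (fun t ht ↦ ?_) measurableSet_Ioi
  rw [norm_mul, norm_real, Real.norm_eq_abs, abs_of_pos ht, norm_cexp_mul_ofReal]

/-- `∫₀^∞ t e^{at} dt = 1/a²` for `Re a < 0` (Suzuki2023 (2.2)). [cite: Suzuki2023, §2.1 (2.2)] -/
theorem integral_ofReal_mul_cexp (ha : a.re < 0) :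
    ∫ t in Ioi (0 : ℝ), (t : ℂ) * cexp (a * t) = 1 / a ^ 2 := by
  have ha0 : a ≠ 0 := fun h ↦ by rw [h] at ha; simp at ha
  have hC : ∀ w : ℂ, HasDerivAt (fun w : ℂ ↦ (w / a - 1 / a ^ 2) * cexp (a * w))
      (w * cexp (a * w)) w := by
    intro w
    have h1 : HasDerivAt (fun w : ℂ ↦ w / a - 1 / a ^ 2) (1 / a) w := by
      simpa using ((hasDerivAt_id w).div_const a).sub_const (1 / a ^ 2)
    have h2 : HasDerivAt (fun w : ℂ ↦ cexp (a * w)) (cexp (a * w) * a) w := by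
      simpa using ((hasDerivAt_id w).const_mul a).cexp
    refine (h1.mul h2).congr_deriv ?_
    field_simp
    ring
  have hderiv : ∀ t ∈ Ioi (0 : ℝ),
      HasDerivAt (fun t : ℝ ↦ ((t : ℂ) / a - 1 / a ^ 2) * cexp (a * t)) ((t : ℂ) * cexp (a * t)) t :=
    fun t _ ↦ (hC t).comp_ofReal
  have hlim : Tendsto (fun t : ℝ ↦ ((t : ℂ) / a - 1 / a ^ 2) * cexp (a * t)) atTop (𝓝 0) := by
    have h1 := (tendsto_ofReal_mul_cexp_atTop ha).const_mul (1 / a)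
    have h3 := (tendsto_cexp_atTop ha).const_mul (1 / a ^ 2)
    rw [mul_zero] at h1 h3
    have h4 := h1.sub h3
    rw [sub_zero] at h4
    refine h4.congr fun t ↦ ?_
    ring
  have hcont : ContinuousWithinAt (fun t : ℝ ↦ ((t : ℂ) / a - 1 / a ^ 2) * cexp (a * t))
      (Ici 0) 0 :=
    (by fun_prop : Continuous fun t : ℝ ↦ ((t : ℂ) / a - 1 / a ^ 2) * cexp (a * t)).continuousWithinAt
  rw [integral_Ioi_of_hasDerivAt_of_tendsto hcont hderiv (integrableOn_ofReal_mul_cexp ha) hlim]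
  simp

/-- The kernel `(t - ℓ)₊ e^{at}` of the prime sum is dominated by `t e^{(Re a)t}` (`ℓ ≥ 0`), hence
integrable on `(0, ∞)`. [folklore] -/
theorem integrableOn_max_sub_mul_cexp {ℓ : ℝ} (hL : 0 ≤ ℓ) (ha : a.re < 0) :
    IntegrableOn (fun t : ℝ ↦ ((max (t - ℓ) 0 : ℝ) : ℂ) * cexp (a * t)) (Ioi 0) := by
  refine Integrable.mono (integrableOn_ofReal_mul_cexp ha) (by fun_prop) ?_
  refine (ae_restrict_mem measurableSet_Ioi).mono fun t ht ↦ ?_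
  rw [norm_mul, norm_mul, norm_real, norm_real, Real.norm_eq_abs, Real.norm_eq_abs,
    abs_of_pos (mem_Ioi.1 ht), abs_of_nonneg (le_max_right _ _)]
  gcongr
  exact max_le (by linarith) (mem_Ioi.1 ht).le

/-- `∫₀^∞ (t - ℓ)₊ e^{at} dt = e^{aL}/a²` for `ℓ ≥ 0`, `Re a < 0` (Suzuki2023 §2.1, the third
displayed formula: `∫₀^∞ (t - log n) 𝟙_{[log n, ∞)}(t) e^{izt} dt = -z^{-2} n^{iz}`). [cite: Suzuki2023, §2.1] -/
theorem integral_max_sub_mul_cexp {ℓ : ℝ} (hL : 0 ≤ ℓ) (ha : a.re < 0) :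
    ∫ t in Ioi (0 : ℝ), ((max (t - ℓ) 0 : ℝ) : ℂ) * cexp (a * t) = cexp (a * ℓ) / a ^ 2 := by
  have ha0 : a ≠ 0 := fun h ↦ by rw [h] at ha; simp at ha
  -- the integrand vanishes on `(0, ℓ]`
  rw [setIntegral_eq_of_subset_of_forall_sdiff_eq_zero (s := Ioi ℓ) measurableSet_Ioi
    (Ioi_subset_Ioi hL) (fun t ht ↦ by
      have htL : t ≤ ℓ := not_lt.1 fun h ↦ ht.2 h
      rw [max_eq_right (by linarith), Complex.ofReal_zero, zero_mul])]
  -- on `(ℓ, ∞)` it is the derivative of `((t - ℓ)/a - 1/a²) e^{at}`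
  have hC : ∀ w : ℂ, HasDerivAt (fun w : ℂ ↦ ((w - ℓ) / a - 1 / a ^ 2) * cexp (a * w))
      ((w - ℓ) * cexp (a * w)) w := by
    intro w
    have h1 : HasDerivAt (fun w : ℂ ↦ (w - ℓ) / a - 1 / a ^ 2) (1 / a) w := by
      simpa using (((hasDerivAt_id w).sub_const (ℓ : ℂ)).div_const a).sub_const (1 / a ^ 2)
    have h2 : HasDerivAt (fun w : ℂ ↦ cexp (a * w)) (cexp (a * w) * a) w := by
      simpa using ((hasDerivAt_id w).const_mul a).cexp
    refine (h1.mul h2).congr_deriv ?_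
    field_simp
    ring
  have hderiv : ∀ t ∈ Ioi ℓ,
      HasDerivAt (fun t : ℝ ↦ (((t : ℂ) - ℓ) / a - 1 / a ^ 2) * cexp (a * t))
        (((max (t - ℓ) 0 : ℝ) : ℂ) * cexp (a * t)) t := by
    intro t ht
    rw [max_eq_left (sub_nonneg.2 (le_of_lt (mem_Ioi.1 ht))), Complex.ofReal_sub]
    exact (hC t).comp_ofReal
  have hlim : Tendsto (fun t : ℝ ↦ (((t : ℂ) - ℓ) / a - 1 / a ^ 2) * cexp (a * t)) atTop (𝓝 0) := by
    have h1 := (tendsto_ofReal_mul_cexp_atTop ha).const_mul (1 / a)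
    have h3 := (tendsto_cexp_atTop ha).const_mul ((ℓ : ℂ) / a + 1 / a ^ 2)
    rw [mul_zero] at h1 h3
    have h4 := h1.sub h3
    rw [sub_zero] at h4
    refine h4.congr fun t ↦ ?_
    ring
  have hcont : ContinuousWithinAt (fun t : ℝ ↦ (((t : ℂ) - ℓ) / a - 1 / a ^ 2) * cexp (a * t))
      (Ici ℓ) ℓ :=
    (by fun_prop : Continuous fun t : ℝ ↦ (((t : ℂ) - ℓ) / a - 1 / a ^ 2) * cexp (a * t)).continuousWithinAt
  rw [integral_Ioi_of_hasDerivAt_of_tendsto hcont hderiv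
    ((integrableOn_max_sub_mul_cexp hL ha).mono_set (Ioi_subset_Ioi hL)) hlim]
  simp only [sub_self, zero_div, zero_sub]
  ring

/-- Real form: `∫₀^∞ (t - ℓ)₊ e^{rt} dt = e^{rL}/r²` (`ℓ ≥ 0`, `r < 0`). [folklore] -/
theorem integral_max_sub_mul_exp {ℓ r : ℝ} (hL : 0 ≤ ℓ) (hr : r < 0) :
    ∫ t in Ioi (0 : ℝ), max (t - ℓ) 0 * Real.exp (r * t) = Real.exp (r * ℓ) / r ^ 2 := by
  have h := integral_max_sub_mul_cexp (a := (r : ℂ)) hL (by simpa using hr)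
  have h' : ∫ t in Ioi (0 : ℝ), ((max (t - ℓ) 0 : ℝ) : ℂ) * cexp ((r : ℂ) * t) =
      ∫ t in Ioi (0 : ℝ), ((max (t - ℓ) 0 * Real.exp (r * t) : ℝ) : ℂ) := by
    refine setIntegral_congr_fun measurableSet_Ioi fun t _ ↦ ?_
    simp only [Complex.ofReal_mul, Complex.ofReal_exp]
  rw [h', integral_complex_ofReal] at h
  exact_mod_cast h

/-- `∫₀^∞ (1 - e^{-ct}) e^{at} dt = -1/a + 1/(a - c)` for `c ≥ 0`, `Re a < 0` (the termwise
transform of the Hurwitz–Lerch part, Suzuki2023 §2.1). [cite: Suzuki2023, §2.1] -/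
theorem integral_one_sub_exp_mul_cexp {c : ℝ} (hc : 0 ≤ c) (ha : a.re < 0) :
    ∫ t in Ioi (0 : ℝ), ((1 - Real.exp (-c * t) : ℝ) : ℂ) * cexp (a * t) =
      -1 / a + 1 / (a - c) := by
  have ha' : a.re < -(-c) := by linarith
  have hsplit : ∀ t : ℝ, ((1 - Real.exp (-c * t) : ℝ) : ℂ) * cexp (a * t) =
      cexp (a * t) - (Real.exp (-c * t) : ℂ) * cexp (a * t) := by
    intro t
    push_cast
    ring
  simp_rw [hsplit]
  rw [integral_sub (integrableOn_exp_mul_complex_Ioi ha 0) (integrableOn_exp_mul_cexp ha'),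
    integral_cexp ha, integral_exp_mul_cexp ha']
  push_cast
  ring

/-- Integrability of `(1 - e^{-ct}) e^{at}` on `(0, ∞)` (`c ≥ 0`, `Re a < 0`). [folklore] -/
theorem integrableOn_one_sub_exp_mul_cexp {c : ℝ} (hc : 0 ≤ c) (ha : a.re < 0) :
    IntegrableOn (fun t : ℝ ↦ ((1 - Real.exp (-c * t) : ℝ) : ℂ) * cexp (a * t)) (Ioi 0) := by
  have ha' : a.re < -(-c) := by linarith
  have hsplit : (fun t : ℝ ↦ ((1 - Real.exp (-c * t) : ℝ) : ℂ) * cexp (a * t)) =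
      fun t : ℝ ↦ cexp (a * t) - (Real.exp (-c * t) : ℂ) * cexp (a * t) := by
    funext t
    push_cast
    ring
  rw [hsplit]
  exact (integrableOn_exp_mul_complex_Ioi ha 0).sub (integrableOn_exp_mul_cexp ha')

/-- Norm bound `‖(1 - e^{-ct}) e^{at}‖ ≤ e^{(Re a)t}` for `t > 0`, `c ≥ 0`. [folklore] -/
theorem norm_one_sub_exp_mul_cexp_le {c : ℝ} (hc : 0 ≤ c) (a : ℂ) {t : ℝ} (ht : 0 < t) :
    ‖((1 - Real.exp (-c * t) : ℝ) : ℂ) * cexp (a * t)‖ ≤ Real.exp (a.re * t) := by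
  rw [norm_mul, norm_real, Real.norm_eq_abs, norm_cexp_mul_ofReal]
  have h1 : Real.exp (-c * t) ≤ 1 := by
    rw [Real.exp_le_one_iff]
    nlinarith
  have h0 : 0 ≤ 1 - Real.exp (-c * t) := by linarith
  rw [abs_of_nonneg h0]
  have : 1 - Real.exp (-c * t) ≤ 1 := by linarith [Real.exp_pos (-c * t)]
  calc (1 - Real.exp (-c * t)) * Real.exp (a.re * t) ≤ 1 * Real.exp (a.re * t) := by
        gcongr
    _ = Real.exp (a.re * t) := one_mul _

/-! ### Integrability of a sum of integrable functions with summable `L¹` norms -/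

/-- If `f` is a.e.-strongly measurable and `‖f‖ = Σ_i ‖F_i‖` a.e. with `Σ_i ∫ ‖F_i‖ < ∞`, then `f` is
integrable (monotone convergence). [folklore] -/
theorem integrable_of_hasSum_norm {ι : Type*} [Countable ι] {F : ι → ℝ → ℂ} {f : ℝ → ℂ}
    {μ : Measure ℝ} (hf : AEStronglyMeasurable f μ) (hF_int : ∀ i, Integrable (F i) μ)
    (hF_sum : Summable fun i ↦ ∫ x, ‖F i x‖ ∂μ)
    (hnorm : ∀ᵐ x ∂μ, HasSum (fun i ↦ ‖F i x‖) ‖f x‖) : Integrable f μ := by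
  refine ⟨hf, ?_⟩
  have h1 : ∀ᵐ x ∂μ, ‖f x‖ₑ = ∑' i, ‖F i x‖ₑ := by
    filter_upwards [hnorm] with x hx
    rw [← ofReal_norm, ← hx.tsum_eq,
      ENNReal.ofReal_tsum_of_nonneg (fun i ↦ norm_nonneg _) hx.summable]
    simp_rw [ofReal_norm]
  have h2 : ∫⁻ x, ‖f x‖ₑ ∂μ = ∑' i, ∫⁻ x, ‖F i x‖ₑ ∂μ := by
    rw [lintegral_congr_ae h1, lintegral_tsum (fun i ↦ (hF_int i).1.enorm)]
  have h3 : ∀ i, ∫⁻ x, ‖F i x‖ₑ ∂μ = ENNReal.ofReal (∫ x, ‖F i x‖ ∂μ) := fun i ↦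
    (ofReal_integral_norm_eq_lintegral_enorm (hF_int i)).symm
  simp_rw [HasFiniteIntegral, h2, h3]
  rw [← ENNReal.ofReal_tsum_of_nonneg (fun i ↦ integral_nonneg fun x ↦ norm_nonneg _) hF_sum]
  exact ENNReal.ofReal_lt_top

/-! ### The prime sum `φ(t) = Σ_{n ≤ e^t} Λ(n) n^{-1/2} (t - log n)` -/

/-- For `t ≥ 0`, `φ(t) = Σ_{n ≥ 0} Λ(n) n^{-1/2} (t - log n)₊` (a finitely supported sum). [folklore] -/
theorem hasSum_primeTerm {t : ℝ} (ht : 0 ≤ t) :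
    HasSum (fun n : ℕ ↦ Λ n / Real.sqrt n * max (t - Real.log n) 0) (zetaScrewPrimeSum t) := by
  set M : ℕ := ⌈Real.exp t⌉₊ with hMdef
  have hM : Real.exp |t| ≤ M := by rw [abs_of_nonneg ht]; exact Nat.le_ceil _
  rw [zetaScrewPrimeSum_eq_sum_max hM, abs_of_nonneg ht]
  refine hasSum_sum_of_ne_finset_zero fun n hn ↦ ?_
  rw [Finset.mem_Icc, not_and_or, not_le, not_le] at hn
  rcases hn with hn | hn
  · have : n = 0 := by omega
    subst this
    simp
  · have hn0 : (0 : ℝ) < n := by exact_mod_cast lt_of_le_of_lt (Nat.zero_le M) hn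
    have hlt : t < Real.log n := by
      rw [Real.lt_log_iff_exp_lt hn0]
      calc Real.exp t ≤ M := Nat.le_ceil _
        _ < n := by exact_mod_cast hn
    rw [max_eq_right (by linarith), mul_zero]

/-- `φ ≥ 0`. [folklore] -/
theorem zetaScrewPrimeSum_nonneg (t : ℝ) : 0 ≤ zetaScrewPrimeSum t := by
  rw [← zetaScrewPrimeSum_neg, ← zetaScrewPrimeSum_neg, neg_neg]
  rcases le_total 0 t with ht | ht
  · exact (hasSum_primeTerm ht).nonneg fun n ↦ mul_nonneg
      (div_nonneg vonMangoldt_nonneg (Real.sqrt_nonneg _)) (le_max_right _ _)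
  · rw [← zetaScrewPrimeSum_neg]
    exact (hasSum_primeTerm (neg_nonneg.2 ht)).nonneg fun n ↦ mul_nonneg
      (div_nonneg vonMangoldt_nonneg (Real.sqrt_nonneg _)) (le_max_right _ _)

/-- `e^{a log n} = n^a` for `n ≥ 1`. [folklore] -/
theorem cexp_mul_log_natCast {n : ℕ} (hn : n ≠ 0) (a : ℂ) :
    cexp (a * (Real.log n : ℝ)) = (n : ℂ) ^ a := by
  rw [Complex.natCast_log, cpow_def_of_ne_zero (Nat.cast_ne_zero.2 hn), mul_comm]

/-- `n^{1/2 - a} = √n / n^a` for `n ≥ 1`. [folklore] -/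
theorem natCast_cpow_half_sub {n : ℕ} (hn : n ≠ 0) (a : ℂ) :
    (n : ℂ) ^ (1 / 2 - a) = (Real.sqrt n : ℂ) / (n : ℂ) ^ a := by
  rw [cpow_sub _ _ (Nat.cast_ne_zero.2 hn), Real.sqrt_eq_rpow, ofReal_cpow (Nat.cast_nonneg n)]
  push_cast
  ring_nf

/-- The termwise transform equals `a^{-2} Λ(n) n^{-s}`, `s = 1/2 - a`:
`Λ(n) n^{-1/2} · n^{a}/a² = a^{-2} Λ(n)/n^{s}`. [folklore] -/
theorem primeTerm_integral_eq_term {n : ℕ} (a : ℂ) (ha0 : a ≠ 0) :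
    ((Λ n / Real.sqrt n : ℝ) : ℂ) * (cexp (a * (Real.log n : ℝ)) / a ^ 2) =
      1 / a ^ 2 * LSeries.term (fun n ↦ (Λ n : ℂ)) (1 / 2 - a) n := by
  rcases eq_or_ne n 0 with rfl | hn
  · simp
  have hsqrt : (Real.sqrt n : ℂ) ≠ 0 :=
    ofReal_ne_zero.2 (Real.sqrt_ne_zero'.2 (by exact_mod_cast Nat.pos_of_ne_zero hn))
  have hna : (n : ℂ) ^ a ≠ 0 := cpow_ne_zero_iff.2 (Or.inl (Nat.cast_ne_zero.2 hn))
  rw [LSeries.term_of_ne_zero hn, natCast_cpow_half_sub hn, cexp_mul_log_natCast hn]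
  push_cast
  field_simp

/-- The `L¹` norms of the terms: `Λ(n) n^{-1/2} e^{r log n}/r² = r^{-2} ‖Λ(n) n^{-(1/2 - a)}‖`
(`r = Re a`). [folklore] -/
theorem primeTerm_norm_integral_eq {n : ℕ} (a : ℂ) (ha : a.re ≠ 0) :
    Λ n / Real.sqrt n * (Real.exp (a.re * Real.log n) / a.re ^ 2) =
      1 / a.re ^ 2 * ‖LSeries.term (fun n ↦ (Λ n : ℂ)) (1 / 2 - a) n‖ := by
  rcases eq_or_ne n 0 with rfl | hn
  · simp
  have hn0 : (0 : ℝ) < n := by exact_mod_cast Nat.pos_of_ne_zero hn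
  rw [LSeries.norm_term_eq, if_neg hn, Complex.norm_real, Real.norm_eq_abs,
    abs_of_nonneg vonMangoldt_nonneg]
  have hre : (1 / 2 - a).re = 1 / 2 - a.re := by simp
  rw [hre, Real.rpow_sub hn0, ← Real.sqrt_eq_rpow, mul_comm (a.re) (Real.log n),
    ← Real.rpow_def_of_pos hn0]
  have hsqrt : Real.sqrt n ≠ 0 := Real.sqrt_ne_zero'.2 hn0
  have hpow : (n : ℝ) ^ a.re ≠ 0 := (Real.rpow_pos_of_pos hn0 _).ne'
  field_simp

/-- **Laplace transform of the prime sum** (Suzuki2023 (2.3)): for `Re a < -1/2`,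
`t ↦ φ(t) e^{at}` is integrable on `(0, ∞)` and `∫₀^∞ φ(t) e^{at} dt = a^{-2} Σ_n Λ(n) n^{-(1/2-a)}`,
the interchange of sum and integral being justified by absolute convergence. [cite: Suzuki2023, §2.1 (2.3)] -/
theorem integral_primeSum_mul_cexp (ha : a.re < -1 / 2) :
    IntegrableOn (fun t : ℝ ↦ (zetaScrewPrimeSum t : ℂ) * cexp (a * t)) (Ioi 0) ∧
      ∫ t in Ioi (0 : ℝ), (zetaScrewPrimeSum t : ℂ) * cexp (a * t) =
        1 / a ^ 2 * L (fun n ↦ (Λ n : ℂ)) (1 / 2 - a) := by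
  have ha' : a.re < 0 := by linarith
  have ha0 : a ≠ 0 := fun h ↦ by rw [h] at ha'; simp at ha'
  have hre0 : a.re ≠ 0 := ha'.ne
  have hs : 1 < (1 / 2 - a).re := by simp; linarith
  set μ : Measure ℝ := volume.restrict (Ioi 0) with hμ
  -- the terms
  set F : ℕ → ℝ → ℂ := fun n t ↦
    ((Λ n / Real.sqrt n : ℝ) : ℂ) * (((max (t - Real.log n) 0 : ℝ) : ℂ) * cexp (a * t)) with hF
  have hlog : ∀ n : ℕ, 0 ≤ Real.log n := fun n ↦ Real.log_natCast_nonneg n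
  have hF_int : ∀ n, Integrable (F n) μ := fun n ↦
    (integrableOn_max_sub_mul_cexp (hlog n) ha').const_mul _
  -- their integrals
  have hF_val : ∀ n, ∫ t, F n t ∂μ = 1 / a ^ 2 * LSeries.term (fun n ↦ (Λ n : ℂ)) (1 / 2 - a) n := by
    intro n
    simp only [hF, hμ]
    rw [integral_const_mul, integral_max_sub_mul_cexp (hlog n) ha', primeTerm_integral_eq_term a ha0]
  -- their `L¹` norms
  have hF_norm : ∀ n, ∫ t, ‖F n t‖ ∂μ = 1 / a.re ^ 2 * ‖LSeries.term (fun n ↦ (Λ n : ℂ)) (1 / 2 - a) n‖ := by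
    intro n
    have hpt : ∀ t ∈ Ioi (0 : ℝ), ‖F n t‖ =
        Λ n / Real.sqrt n * (max (t - Real.log n) 0 * Real.exp (a.re * t)) := by
      intro t _
      simp only [hF, norm_mul, Complex.norm_real, Real.norm_eq_abs, norm_cexp_mul_ofReal,
        abs_of_nonneg (div_nonneg vonMangoldt_nonneg (Real.sqrt_nonneg _)),
        abs_of_nonneg (le_max_right (t - Real.log n) 0)]
    simp only [hμ]
    rw [setIntegral_congr_fun measurableSet_Ioi hpt, integral_const_mul,
      integral_max_sub_mul_exp (hlog n) ha', primeTerm_norm_integral_eq a hre0]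
  have hF_sum : Summable fun n ↦ ∫ t, ‖F n t‖ ∂μ := by
    simp_rw [hF_norm]
    exact (LSeriesSummable_vonMangoldt hs).norm.mul_left _
  -- pointwise sums on `(0, ∞)`
  have hpt : ∀ t ∈ Ioi (0 : ℝ), HasSum (fun n ↦ F n t) ((zetaScrewPrimeSum t : ℂ) * cexp (a * t)) := by
    intro t ht
    have h := (Complex.hasSum_ofReal.2 (hasSum_primeTerm (le_of_lt ht))).mul_right (cexp (a * t))
    refine h.congr_fun fun n ↦ ?_
    simp only [hF]
    push_cast
    ring
  have hpt_norm : ∀ t ∈ Ioi (0 : ℝ),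
      HasSum (fun n ↦ ‖F n t‖) ‖(zetaScrewPrimeSum t : ℂ) * cexp (a * t)‖ := by
    intro t ht
    have h := (hasSum_primeTerm (le_of_lt ht)).mul_right (Real.exp (a.re * t))
    rw [norm_mul, Complex.norm_real, Real.norm_eq_abs, abs_of_nonneg (zetaScrewPrimeSum_nonneg t),
      norm_cexp_mul_ofReal]
    refine h.congr_fun fun n ↦ ?_
    simp only [hF, norm_mul, Complex.norm_real, Real.norm_eq_abs, norm_cexp_mul_ofReal,
      abs_of_nonneg (div_nonneg vonMangoldt_nonneg (Real.sqrt_nonneg _)),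
      abs_of_nonneg (le_max_right (t - Real.log n) 0)]
    ring
  -- integrability of `φ e^{at}`
  have hint : IntegrableOn (fun t : ℝ ↦ (zetaScrewPrimeSum t : ℂ) * cexp (a * t)) (Ioi 0) := by
    refine integrable_of_hasSum_norm (μ := μ) ?_ hF_int hF_sum ?_
    · exact ((Complex.continuous_ofReal.comp continuous_zetaScrewPrimeSum).mul
        (by fun_prop)).aestronglyMeasurable
    · exact (ae_restrict_mem measurableSet_Ioi).mono hpt_norm
  refine ⟨hint, ?_⟩
  -- interchange of sum and integral
  have hsum := hasSum_integral_of_summable_integral_norm hF_int hF_sum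
  have heq : ∫ t, (∑' n, F n t) ∂μ = ∫ t in Ioi (0 : ℝ), (zetaScrewPrimeSum t : ℂ) * cexp (a * t) := by
    simp only [hμ]
    exact setIntegral_congr_fun measurableSet_Ioi fun t ht ↦ (hpt t ht).tsum_eq
  rw [heq] at hsum
  simp_rw [hF_val] at hsum
  have hL : HasSum (fun n ↦ 1 / a ^ 2 * LSeries.term (fun n ↦ (Λ n : ℂ)) (1 / 2 - a) n)
      (1 / a ^ 2 * L (fun n ↦ (Λ n : ℂ)) (1 / 2 - a)) :=
    (LSeriesSummable_vonMangoldt hs).hasSum.mul_left _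
  exact hsum.unique hL

/-! ### The Hurwitz–Lerch part `C - e^{-t/2} Φ(e^{-2t}, 2, 1/4) = Σ_k (k+¼)^{-2}(1 - e^{-(2k+½)t})` -/

/-- For `t ≥ 0`: `C - e^{-t/2} Φ(e^{-2t},2,¼) = Σ_{k ≥ 0} (1 - e^{-(2k+½)t})/(k+¼)²`
(Suzuki2023 §2.1, using `C = Σ (k+¼)^{-2}`). [cite: Suzuki2023, §2.1] -/
theorem hasSum_hurwitzLerch_part {t : ℝ} (ht : 0 ≤ t) :
    HasSum (fun k : ℕ ↦ (1 - Real.exp (-(2 * k + 1 / 2) * t)) / ((k : ℝ) + 1 / 4) ^ 2)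
      ((∑' k : ℕ, 1 / ((k : ℝ) + 1 / 4) ^ 2) - Real.exp (-(t / 2)) * hurwitzLerchQuarter t) := by
  have h1 := summable_one_div_nat_add_quarter_sq.hasSum
  have h2 := ((summable_hurwitzLerchQuarter t).hasSum).mul_left (Real.exp (-(t / 2)))
  refine (h1.sub h2).congr_fun fun k ↦ ?_
  rw [abs_of_nonneg ht, ← mul_div_assoc, ← Real.exp_add, sub_div]
  congr 2
  ring_nf

/-- The terms of the Hurwitz–Lerch part are non-negative for `t ≥ 0`. [folklore] -/
theorem hurwitzLerch_term_nonneg {t : ℝ} (ht : 0 ≤ t) (k : ℕ) :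
    0 ≤ (1 - Real.exp (-(2 * k + 1 / 2) * t)) / ((k : ℝ) + 1 / 4) ^ 2 := by
  refine div_nonneg ?_ (by positivity)
  have : Real.exp (-(2 * k + 1 / 2) * t) ≤ 1 := by
    rw [Real.exp_le_one_iff]
    have : (0 : ℝ) ≤ 2 * k + 1 / 2 := by positivity
    nlinarith
  linarith

/-- `C - e^{-t/2} Φ(e^{-2t},2,¼) ≥ 0` for `t ≥ 0`. [folklore] -/
theorem hurwitzLerch_part_nonneg {t : ℝ} (ht : 0 ≤ t) :
    0 ≤ (∑' k : ℕ, 1 / ((k : ℝ) + 1 / 4) ^ 2) - Real.exp (-(t / 2)) * hurwitzLerchQuarter t :=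
  (hasSum_hurwitzLerch_part ht).nonneg (hurwitzLerch_term_nonneg ht)

/-- The termwise identity behind (2.4)–(2.5) of Suzuki2023:
`¼ (k+¼)^{-2} (-1/a + 1/(a - 2k - ½)) = (2a²)^{-1} (1/(¼ + k) - 1/(¼ - a/2 + k))`. [cite: Suzuki2023, §2.1 (2.4)] -/
theorem hurwitzLerch_term_identity (k : ℕ) (ha : a.re < 0) :
    (1 / 4 : ℂ) * (((1 / ((k : ℝ) + 1 / 4) ^ 2 : ℝ) : ℂ) * (-1 / a + 1 / (a - (2 * k + 1 / 2 : ℝ)))) =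
      1 / (2 * a ^ 2) * (1 / (1 / 4 + (k : ℂ)) - 1 / (1 / 4 - a / 2 + (k : ℂ))) := by
  have ha0 : a ≠ 0 := fun h ↦ by rw [h] at ha; simp at ha
  set u : ℂ := 1 / 4 + (k : ℂ) with hu_def
  set v : ℂ := 1 / 4 - a / 2 + (k : ℂ) with hv_def
  have hu : u ≠ 0 := by
    intro h
    have := congrArg Complex.re h
    simp [hu_def] at this
    linarith [(Nat.cast_nonneg k : (0 : ℝ) ≤ k)]
  have hv : v ≠ 0 := by
    intro h
    have := congrArg Complex.re h
    simp [hv_def] at this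
    linarith [(Nat.cast_nonneg k : (0 : ℝ) ≤ k)]
  have h2v : (-2 : ℂ) * v ≠ 0 := mul_ne_zero (by norm_num) hv
  have e1 : ((1 / ((k : ℝ) + 1 / 4) ^ 2 : ℝ) : ℂ) = 1 / u ^ 2 := by
    push_cast
    rw [hu_def, add_comm]
  have e2 : -1 / a + 1 / (a - (2 * k + 1 / 2 : ℝ)) = 2 * u / (a * (-2 * v)) := by
    have : (a - (2 * k + 1 / 2 : ℝ)) = -2 * v := by
      push_cast
      rw [hv_def]
      ring
    rw [this, div_add_div _ _ ha0 h2v]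
    congr 1
    rw [hu_def, hv_def]
    ring
  have e3 : 1 / u - 1 / v = (-a / 2) / (u * v) := by
    rw [div_sub_div _ _ hu hv]
    congr 1
    rw [hu_def, hv_def]
    ring
  rw [e1, e2, e3]
  field_simp
  ring

/-- **Laplace transform of the Hurwitz–Lerch part** (Suzuki2023 (2.4)): for `Re a < 0`,
`t ↦ (C - e^{-t/2}Φ(e^{-2t},2,¼)) e^{at}` is integrable on `(0,∞)` and
`∫₀^∞ ¼ (C - e^{-t/2}Φ(e^{-2t},2,¼)) e^{at} dt = (2a²)^{-1} (ψ(¼ - a/2) - ψ(¼))`. [cite: Suzuki2023, §2.1 (2.4)–(2.5)] -/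
theorem integral_hurwitzLerch_mul_cexp (ha : a.re < 0) :
    IntegrableOn (fun t : ℝ ↦ (((∑' k : ℕ, 1 / ((k : ℝ) + 1 / 4) ^ 2)
        - Real.exp (-(t / 2)) * hurwitzLerchQuarter t : ℝ) : ℂ) * cexp (a * t)) (Ioi 0) ∧
      ∫ t in Ioi (0 : ℝ), (1 / 4 : ℂ) * ((((∑' k : ℕ, 1 / ((k : ℝ) + 1 / 4) ^ 2)
        - Real.exp (-(t / 2)) * hurwitzLerchQuarter t : ℝ) : ℂ) * cexp (a * t)) =
        1 / (2 * a ^ 2) * (digamma (1 / 4 - a / 2) - digamma (1 / 4)) := by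
  have ha0 : a ≠ 0 := fun h ↦ by rw [h] at ha; simp at ha
  set μ : Measure ℝ := volume.restrict (Ioi 0) with hμ
  set G : ℕ → ℝ → ℂ := fun k t ↦ (((1 / ((k : ℝ) + 1 / 4) ^ 2 : ℝ) : ℂ)) *
    (((1 - Real.exp (-(2 * k + 1 / 2 : ℝ) * t) : ℝ) : ℂ) * cexp (a * t)) with hG
  have hc : ∀ k : ℕ, (0 : ℝ) ≤ 2 * k + 1 / 2 := fun k ↦ by positivity
  have hG_int : ∀ k, Integrable (G k) μ := fun k ↦
    (integrableOn_one_sub_exp_mul_cexp (hc k) ha).const_mul _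
  have hG_val : ∀ k, ∫ t, G k t ∂μ =
      (((1 / ((k : ℝ) + 1 / 4) ^ 2 : ℝ) : ℂ)) * (-1 / a + 1 / (a - (2 * k + 1 / 2 : ℝ))) := by
    intro k
    simp only [hG, hμ]
    rw [integral_const_mul, integral_one_sub_exp_mul_cexp (hc k) ha]
  -- `L¹` bounds
  have hexp_int : IntegrableOn (fun t : ℝ ↦ Real.exp (a.re * t)) (Ioi 0) := integrableOn_exp_mul_Ioi ha 0
  have hG_norm_le : ∀ k, ∫ t, ‖G k t‖ ∂μ ≤ 1 / ((k : ℝ) + 1 / 4) ^ 2 * (1 / (-a.re)) := by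
    intro k
    have hb : ∫ t, ‖G k t‖ ∂μ ≤ ∫ t, 1 / ((k : ℝ) + 1 / 4) ^ 2 * Real.exp (a.re * t) ∂μ := by
      refine integral_mono_ae (hG_int k).norm (hexp_int.const_mul _) ?_
      refine (ae_restrict_mem measurableSet_Ioi).mono fun t ht ↦ ?_
      simp only [hG]
      rw [norm_mul, Complex.norm_real, Real.norm_eq_abs, abs_of_nonneg (by positivity)]
      gcongr
      exact norm_one_sub_exp_mul_cexp_le (hc k) a ht
    refine hb.trans (le_of_eq ?_)
    simp only [hμ]
    rw [integral_const_mul, integral_exp_mul_Ioi ha 0]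
    simp [neg_div]
  have hG_sum : Summable fun k ↦ ∫ t, ‖G k t‖ ∂μ :=
    Summable.of_nonneg_of_le (fun k ↦ integral_nonneg fun t ↦ norm_nonneg _) hG_norm_le
      (summable_one_div_nat_add_quarter_sq.mul_right _)
  -- pointwise sums on `(0, ∞)`
  have hpt : ∀ t ∈ Ioi (0 : ℝ), HasSum (fun k ↦ G k t)
      ((((∑' k : ℕ, 1 / ((k : ℝ) + 1 / 4) ^ 2)
        - Real.exp (-(t / 2)) * hurwitzLerchQuarter t : ℝ) : ℂ) * cexp (a * t)) := by
    intro t ht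
    have h := (Complex.hasSum_ofReal.2 (hasSum_hurwitzLerch_part (le_of_lt ht))).mul_right
      (cexp (a * t))
    refine h.congr_fun fun k ↦ ?_
    simp only [hG]
    push_cast
    ring
  have hpt_norm : ∀ t ∈ Ioi (0 : ℝ), HasSum (fun k ↦ ‖G k t‖)
      ‖(((∑' k : ℕ, 1 / ((k : ℝ) + 1 / 4) ^ 2)
        - Real.exp (-(t / 2)) * hurwitzLerchQuarter t : ℝ) : ℂ) * cexp (a * t)‖ := by
    intro t ht
    have ht' : 0 ≤ t := le_of_lt ht
    have h := (hasSum_hurwitzLerch_part ht').mul_right (Real.exp (a.re * t))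
    rw [norm_mul, Complex.norm_real, Real.norm_eq_abs, abs_of_nonneg (hurwitzLerch_part_nonneg ht'),
      norm_cexp_mul_ofReal]
    refine h.congr_fun fun k ↦ ?_
    have h0 : 0 ≤ 1 - Real.exp (-(2 * k + 1 / 2 : ℝ) * t) := by
      have := hurwitzLerch_term_nonneg ht' k
      have hpos : (0 : ℝ) < ((k : ℝ) + 1 / 4) ^ 2 := by positivity
      have := mul_nonneg this hpos.le
      rwa [div_mul_cancel₀ _ hpos.ne'] at this
    simp only [hG, norm_mul, Complex.norm_real, Real.norm_eq_abs, norm_cexp_mul_ofReal,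
      abs_of_nonneg h0]
    rw [abs_of_nonneg (by positivity)]
    ring
  have hint : IntegrableOn (fun t : ℝ ↦ (((∑' k : ℕ, 1 / ((k : ℝ) + 1 / 4) ^ 2)
      - Real.exp (-(t / 2)) * hurwitzLerchQuarter t : ℝ) : ℂ) * cexp (a * t)) (Ioi 0) := by
    refine integrable_of_hasSum_norm (μ := μ) ?_ hG_int hG_sum ?_
    · refine (Continuous.mul ?_ (by fun_prop)).aestronglyMeasurable
      exact Complex.continuous_ofReal.comp (continuous_const.sub
        ((Real.continuous_exp.comp (continuous_id.div_const _).neg).mul continuous_hurwitzLerchQuarter))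
    · exact (ae_restrict_mem measurableSet_Ioi).mono hpt_norm
  refine ⟨hint, ?_⟩
  -- interchange and evaluation of the sum by the digamma series
  have hsum := hasSum_integral_of_summable_integral_norm hG_int hG_sum
  have heq : ∫ t, (∑' k, G k t) ∂μ = ∫ t in Ioi (0 : ℝ), (((∑' k : ℕ, 1 / ((k : ℝ) + 1 / 4) ^ 2)
      - Real.exp (-(t / 2)) * hurwitzLerchQuarter t : ℝ) : ℂ) * cexp (a * t) := by
    simp only [hμ]
    exact setIntegral_congr_fun measurableSet_Ioi fun t ht ↦ (hpt t ht).tsum_eq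
  rw [heq] at hsum
  simp_rw [hG_val] at hsum
  have hsum4 := hsum.mul_left (1 / 4 : ℂ)
  rw [← integral_const_mul] at hsum4
  -- the digamma series
  have hw₁ : 0 < (1 / 4 - a / 2 : ℂ).re := by simp; linarith
  have hw₀ : 0 < (1 / 4 : ℂ).re := by norm_num
  have hd := (Literature.Analysis.SpecialFunctions.Complex.hasSum_one_div_sub_one_div_digamma hw₁).sub
    (Literature.Analysis.SpecialFunctions.Complex.hasSum_one_div_sub_one_div_digamma hw₀)
  have hval : digamma (1 / 4 - a / 2) + (Real.eulerMascheroniConstant : ℂ) -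
      (digamma (1 / 4) + (Real.eulerMascheroniConstant : ℂ)) =
      digamma (1 / 4 - a / 2) - digamma (1 / 4) := by ring
  rw [hval] at hd
  have hd' : HasSum (fun k : ℕ ↦ 1 / (2 * a ^ 2) * (1 / (1 / 4 + (k : ℂ)) - 1 / (1 / 4 - a / 2 + (k : ℂ))))
      (1 / (2 * a ^ 2) * (digamma (1 / 4 - a / 2) - digamma (1 / 4))) := by
    refine (hd.mul_left (1 / (2 * a ^ 2))).congr_fun fun k ↦ ?_
    ring
  have hsum4' : HasSum (fun k : ℕ ↦ 1 / (2 * a ^ 2) * (1 / (1 / 4 + (k : ℂ)) - 1 / (1 / 4 - a / 2 + (k : ℂ))))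
      (∫ t in Ioi (0 : ℝ), (1 / 4 : ℂ) * ((((∑' k : ℕ, 1 / ((k : ℝ) + 1 / 4) ^ 2)
        - Real.exp (-(t / 2)) * hurwitzLerchQuarter t : ℝ) : ℂ) * cexp (a * t))) := by
    refine hsum4.congr_fun fun k ↦ ?_
    exact (hurwitzLerch_term_identity k ha).symm
  exact hsum4'.unique hd'

/-! ### Assembly: the transform of `Ψ` -/

/-- `∫₀^∞ e^{t/2} e^{at} dt = -1/(a + 1/2)` (`Re a < -1/2`). [cite: Suzuki2023, §2.1 (2.1)] -/
theorem integral_exp_half_mul_cexp (ha : a.re < -1 / 2) :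
    ∫ t in Ioi (0 : ℝ), (Real.exp (t / 2) : ℂ) * cexp (a * t) = -1 / (a + 1 / 2) := by
  have h := integral_exp_mul_cexp (a := a) (c := 1 / 2) (by linarith)
  simp_rw [show ∀ t : ℝ, (1 / 2 : ℝ) * t = t / 2 from fun t ↦ by ring] at h
  rw [h]
  push_cast
  ring

/-- `∫₀^∞ e^{-t/2} e^{at} dt = -1/(a - 1/2)` (`Re a < 1/2`). [cite: Suzuki2023, §2.1 (2.1)] -/
theorem integral_exp_neg_half_mul_cexp (ha : a.re < 1 / 2) :
    ∫ t in Ioi (0 : ℝ), (Real.exp (-(t / 2)) : ℂ) * cexp (a * t) = -1 / (a - 1 / 2) := by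
  have h := integral_exp_mul_cexp (a := a) (c := -(1 / 2)) (by linarith)
  simp_rw [show ∀ t : ℝ, (-(1 / 2) : ℝ) * t = -(t / 2) from fun t ↦ by ring] at h
  rw [h]
  push_cast
  ring

/-- On `t > 0`, `Ψ(t) e^{at}` splits into its four parts ((1.1) of Suzuki2023 with `|t| = t`). [cite: Suzuki2023, (1.1)] -/
theorem zetaScrew_mul_cexp_eq {t : ℝ} (ht : 0 < t) (a : ℂ) :
    (zetaScrew t : ℂ) * cexp (a * t) =
      4 * ((Real.exp (t / 2) : ℂ) * cexp (a * t) + (Real.exp (-(t / 2)) : ℂ) * cexp (a * t)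
          - 2 * cexp (a * t))
        - (zetaScrewPrimeSum t : ℂ) * cexp (a * t)
        - ((Real.eulerMascheroniConstant + Real.pi / 2 + 3 * Real.log 2 + Real.log Real.pi : ℝ) : ℂ) / 2
            * ((t : ℂ) * cexp (a * t))
        + (1 / 4 : ℂ) * ((((∑' k : ℕ, 1 / ((k : ℝ) + 1 / 4) ^ 2)
            - Real.exp (-(t / 2)) * hurwitzLerchQuarter t : ℝ) : ℂ) * cexp (a * t)) := by
  rw [zetaScrew_eq, abs_of_pos ht]
  push_cast
  ring

/-- **Suzuki2023 Thm 1.1 (1) in the Laplace variable.** For `Re a < -1/2`, `t ↦ Ψ(t) e^{at}` is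
integrable on `(0, ∞)` and `∫₀^∞ Ψ(t) e^{at} dt = a^{-2} (ξ'/ξ)(1/2 - a)`. [cite: Suzuki2023, Thm 1.1 (1)] -/
theorem integral_zetaScrew_mul_cexp (ha : a.re < -1 / 2) :
    IntegrableOn (fun t : ℝ ↦ (zetaScrew t : ℂ) * cexp (a * t)) (Ioi 0) ∧
      ∫ t in Ioi (0 : ℝ), (zetaScrew t : ℂ) * cexp (a * t) =
        1 / a ^ 2 * logDeriv riemannXi (1 / 2 - a) := by
  have ha' : a.re < 0 := by linarith
  have ha0 : a ≠ 0 := fun h ↦ by rw [h] at ha'; simp at ha'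
  have hs : 1 < (1 / 2 - a).re := by simp; linarith
  -- the four parts
  set f₁ : ℝ → ℂ := fun t ↦ 4 * ((Real.exp (t / 2) : ℂ) * cexp (a * t)
      + (Real.exp (-(t / 2)) : ℂ) * cexp (a * t) - 2 * cexp (a * t)) with hf₁
  set f₂ : ℝ → ℂ := fun t ↦ (zetaScrewPrimeSum t : ℂ) * cexp (a * t) with hf₂
  set κ : ℝ := Real.eulerMascheroniConstant + Real.pi / 2 + 3 * Real.log 2 + Real.log Real.pi with hκ
  set f₃ : ℝ → ℂ := fun t ↦ (κ : ℂ) / 2 * ((t : ℂ) * cexp (a * t)) with hf₃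
  set f₄ : ℝ → ℂ := fun t ↦ (1 / 4 : ℂ) * ((((∑' k : ℕ, 1 / ((k : ℝ) + 1 / 4) ^ 2)
      - Real.exp (-(t / 2)) * hurwitzLerchQuarter t : ℝ) : ℂ) * cexp (a * t)) with hf₄
  have heq : EqOn (fun t : ℝ ↦ (zetaScrew t : ℂ) * cexp (a * t))
      (fun t ↦ f₁ t - f₂ t - f₃ t + f₄ t) (Ioi 0) := by
    intro t ht
    simp only [hf₁, hf₂, hf₃, hf₄, hκ]
    exact zetaScrew_mul_cexp_eq ht a
  -- integrability of the parts
  have h1a : IntegrableOn (fun t : ℝ ↦ (Real.exp (t / 2) : ℂ) * cexp (a * t)) (Ioi 0) := by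
    have h := integrableOn_exp_mul_cexp (a := a) (c := 1 / 2) (by linarith)
    refine h.congr_fun (fun t _ ↦ ?_) measurableSet_Ioi
    dsimp only
    rw [show (1 / 2 : ℝ) * t = t / 2 by ring]
  have h1b : IntegrableOn (fun t : ℝ ↦ (Real.exp (-(t / 2)) : ℂ) * cexp (a * t)) (Ioi 0) := by
    have h := integrableOn_exp_mul_cexp (a := a) (c := -(1 / 2)) (by linarith)
    refine h.congr_fun (fun t _ ↦ ?_) measurableSet_Ioi
    dsimp only
    rw [show (-(1 / 2) : ℝ) * t = -(t / 2) by ring]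
  have h1c : IntegrableOn (fun t : ℝ ↦ cexp (a * t)) (Ioi 0) := integrableOn_exp_mul_complex_Ioi ha' 0
  have h1ab : IntegrableOn (fun t : ℝ ↦ (Real.exp (t / 2) : ℂ) * cexp (a * t)
      + (Real.exp (-(t / 2)) : ℂ) * cexp (a * t)) (Ioi 0) := h1a.add h1b
  have h1c2 : IntegrableOn (fun t : ℝ ↦ 2 * cexp (a * t)) (Ioi 0) := h1c.const_mul 2
  have h1abc : IntegrableOn (fun t : ℝ ↦ (Real.exp (t / 2) : ℂ) * cexp (a * t)
      + (Real.exp (-(t / 2)) : ℂ) * cexp (a * t) - 2 * cexp (a * t)) (Ioi 0) := h1ab.sub h1c2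
  have hi₁ : IntegrableOn f₁ (Ioi 0) := h1abc.const_mul 4
  obtain ⟨hi₂', hI₂⟩ := integral_primeSum_mul_cexp ha
  have hi₂ : IntegrableOn f₂ (Ioi 0) := hi₂'
  have hi₃ : IntegrableOn f₃ (Ioi 0) := (integrableOn_ofReal_mul_cexp ha').const_mul _
  obtain ⟨hi₄', hI₄⟩ := integral_hurwitzLerch_mul_cexp ha'
  have hi₄ : IntegrableOn f₄ (Ioi 0) := hi₄'.const_mul _
  have hi₁₂ : IntegrableOn (fun t ↦ f₁ t - f₂ t) (Ioi 0) := hi₁.sub hi₂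
  have hi₁₂₃ : IntegrableOn (fun t ↦ f₁ t - f₂ t - f₃ t) (Ioi 0) := hi₁₂.sub hi₃
  have hi₁₂₃₄ : IntegrableOn (fun t ↦ f₁ t - f₂ t - f₃ t + f₄ t) (Ioi 0) := hi₁₂₃.add hi₄
  have hint : IntegrableOn (fun t : ℝ ↦ (zetaScrew t : ℂ) * cexp (a * t)) (Ioi 0) :=
    hi₁₂₃₄.congr_fun heq.symm measurableSet_Ioi
  refine ⟨hint, ?_⟩
  -- the integrals of the parts
  have hI₁ : ∫ t in Ioi (0 : ℝ), f₁ t = 4 * (-1 / (a + 1 / 2) + -1 / (a - 1 / 2) - 2 * (-1 / a)) := by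
    simp only [hf₁]
    rw [integral_const_mul, integral_sub h1ab h1c2, integral_add h1a h1b,
      integral_const_mul, integral_exp_half_mul_cexp ha, integral_exp_neg_half_mul_cexp (by linarith),
      integral_cexp ha']
  have hI₂' : ∫ t in Ioi (0 : ℝ), f₂ t = 1 / a ^ 2 * L (fun n ↦ (Λ n : ℂ)) (1 / 2 - a) := hI₂
  have hI₃ : ∫ t in Ioi (0 : ℝ), f₃ t = (κ : ℂ) / 2 * (1 / a ^ 2) := by
    simp only [hf₃]
    rw [integral_const_mul, integral_ofReal_mul_cexp ha']
  have hI₄' : ∫ t in Ioi (0 : ℝ), f₄ t = 1 / (2 * a ^ 2) * (digamma (1 / 4 - a / 2) - digamma (1 / 4)) :=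
    hI₄
  rw [setIntegral_congr_fun measurableSet_Ioi heq, integral_add hi₁₂₃ hi₄,
    integral_sub hi₁₂ hi₃, integral_sub hi₁ hi₂, hI₁, hI₂', hI₃, hI₄']
  rw [logDeriv_riemannXi_eq_of_one_lt_re hs,
    show (1 / 2 - a) / 2 = 1 / 4 - a / 2 by ring,
    Literature.Analysis.SpecialFunctions.Complex.digamma_one_quarter_eq_neg_ofReal]
  -- final algebra
  set p : ℂ := a + 1 / 2 with hp_def
  set q : ℂ := a - 1 / 2 with hq_def
  have hp : p ≠ 0 := by
    intro h
    have := congrArg Complex.re h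
    simp [hp_def] at this
    linarith
  have hq : q ≠ 0 := by
    intro h
    have := congrArg Complex.re h
    simp [hq_def] at this
    linarith
  have e1 : (1 : ℂ) / 2 - a - 1 = -p := by rw [hp_def]; ring
  have e2 : (1 : ℂ) / 2 - a = -q := by rw [hq_def]; ring
  rw [e1, e2]
  simp only [hκ]
  push_cast
  field_simp
  ring

end ZetaScrewLaplace

/-- **Suzuki2023 Thm 1.1 (1)** — discharge of the named fact
`Literature.NumberTheory.LFunctions.Suzuki2023_thm11_fourier`: for `Im z > 1/2`,
`t ↦ Ψ(t) e^{izt}` is integrable on `(0, ∞)` and `∫₀^∞ Ψ(t) e^{izt} dt = -z^{-2} (ξ'/ξ)(1/2 - iz)`.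
Proof: `ZetaScrewLaplace.integral_zetaScrew_mul_cexp` with `a = iz` (Suzuki2023 §2.1).
[cite: Suzuki2023, Thm 1.1 (1)] -/
theorem Suzuki2023_thm11_fourier_holds : Suzuki2023_thm11_fourier := by
  intro z hz
  have ha : (I * z).re < -1 / 2 := by simp; linarith
  obtain ⟨hint, hval⟩ := ZetaScrewLaplace.integral_zetaScrew_mul_cexp ha
  refine ⟨hint, ?_⟩
  rw [hval, logDeriv_apply]
  have hI : (I * z) ^ 2 = -z ^ 2 := by rw [mul_pow, I_sq]; ring
  rw [hI, div_neg]

end Literature.NumberTheory.LFunctions
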